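import Mathlib
import Summits.AnomalousDissipation.AnomalousDissipation.Theses.DyadicWallCascade

/-!
# The hierarchy inside the antecedent of `DyadicRealisation` must have a non-zero Lamb vector `ω × V`
# (negative lemma, crux stmt-AnomalousDissipation-17918; disprover seat cdisprove-17918)

Refuter file, Negative lane (D-0016), route `DyadicWallCascade` of `Summits/AnomalousDissipation`,
sub-problem `AnomalousDissipation`.

The antecedent of the crux `DyadicRealisation` (= support `ViscousWallProfile`) contains the clause
block of crux #2 `HalfSpaceHierarchy`: a bounded `C^∞` steady Euler flow `(V, Q)` on the open upper
half-space `H = {X₂ > 0}` with zero mass flux and NON-ZERO energy flux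
`F = ∫_{[0,1]²} V₂ (|V|²/2 + Q)` through the unit square of the plane `X₂ = 1`.

The most obvious explicit family of candidates — and the one with the dilation symmetry built in
for free — are POTENTIAL flows `V = ∇φ` (`φ` harmonic, `1`-homogeneous, so that `V` has degree
`0`).  This file closes that door — together with the other classical explicit family, the (generalised)
BELTRAMI flows `ω = λ V` (ABC flows and their kin) — H-free and unconditionally: a steady Euler
flow whose Lamb vector `ω × V = DV(V) − DVᵀ(V)` vanishes on `H` (`⟪DV(V), b⟫ = ⟪V, DV b⟫` for all
`b`; irrotational = symmetric Jacobian, Beltrami = `ω ∥ V`) has a constant Bernoulli function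
`|V|²/2 + Q` on the (convex, open) half-space (`bernoulli_const_of_lamb_zero`: `∇(|V|²/2 + Q) =
V × ω = 0` by the Euler clause, then `Convex.is_const_of_fderivWithin_eq_zero`), so its energy flux
through the plane is the Bernoulli constant times the mass flux, i.e. ZERO
(`flux_eq_zero_of_lamb_zero`); hence

* `not_hierarchyBlock_of_lamb_zero` — no witness of the hierarchy block has `ω × V = 0`;
* `not_profileBlock_of_lamb_zero` — no witness of the antecedent of `DyadicRealisation` has a
  hierarchy with `ω × V = 0`: the blow-down `V` of any viscous wall profile has a NON-TRIVIAL Lamb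
  vector on `H` — the energy flux to the wall is carried exactly by `⟨V₂ B⟩` with
  `∇B = V × ω ≠ 0` (consistent with the route's mechanism — flux-carrying channels of different
  head separated by vortex sheaths — and recorded so that potential / Beltrami "witnesses" are
  not proposed for crux #2/#3).

* `exists_lamb_ne_zero_of_viscousWallProfile` — the same, hung on the route decl: every witness of
  `ViscousWallProfile` has a point of the half-space where `ω × V ≠ 0`.
* `flux_eq_zero_of_vertical_sign`, `exists_downdraft_and_updraft_of_viscousWallProfile` — a second
  cheap exclusion in the same spirit: one-signed vertical velocity on the unit square of `X₂ = 1`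
  plus zero mass flux kills the energy flux, so every witness has both a down-draft and an
  up-draft through that square.

Only the smoothness, Euler, zero-mass-flux and energy-flux clauses of the `V`-block are used.
-/

open scoped BigOperators Topology InnerProductSpace
open Filter Set MeasureTheory

-- `Summit.<Summit>.<Problem>` is the tree's mandated summit-side namespace (CONVENTIONS §2); for this
-- single-conjunct summit the two coincide, so the duplicate is deliberate.
set_option linter.dupNamespace false

namespace Summit.AnomalousDissipation.AnomalousDissipation.Theorems

namespace DyadicWallCascadeNegative

/-- **Bernoulli's theorem for steady Euler flows with vanishing Lamb vector on the half-space.**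
If `(V, Q)` are `C^∞` on `H = {X₂ > 0}`, satisfy the Euler clause `DV(X)(V X) + ∇Q(X) = 0` there,
and the Lamb vector `ω × V = DV(V) − DVᵀ(V)` vanishes on `H` (`⟪DV(V), b⟫ = ⟪V, DV b⟫` for all
`b`: irrotational flows, and Beltrami flows `ω = λ V`), then the Bernoulli function `|V|²/2 + Q`
is constant on `H`. [folklore] -/
theorem bernoulli_const_of_lamb_zero
    {V : EuclideanSpace ℝ (Fin 3) → EuclideanSpace ℝ (Fin 3)} {Q : EuclideanSpace ℝ (Fin 3) → ℝ}
    (hVs : ContDiffOn ℝ ((⊤ : ℕ∞) : WithTop ℕ∞) V {X : EuclideanSpace ℝ (Fin 3) | 0 < X 2})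
    (hQs : ContDiffOn ℝ ((⊤ : ℕ∞) : WithTop ℕ∞) Q {X : EuclideanSpace ℝ (Fin 3) | 0 < X 2})
    (hEul : ∀ X ∈ {X : EuclideanSpace ℝ (Fin 3) | 0 < X 2}, (fderiv ℝ V X) (V X) + gradient Q X = 0)
    (hlamb : ∀ X ∈ {X : EuclideanSpace ℝ (Fin 3) | 0 < X 2}, ∀ b : EuclideanSpace ℝ (Fin 3),
      ⟪fderiv ℝ V X (V X), b⟫_ℝ = ⟪V X, fderiv ℝ V X b⟫_ℝ)
    {X Y : EuclideanSpace ℝ (Fin 3)} (hX : 0 < X 2) (hY : 0 < Y 2) :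
    ‖V X‖ ^ 2 / 2 + Q X = ‖V Y‖ ^ 2 / 2 + Q Y := by
  set H : Set (EuclideanSpace ℝ (Fin 3)) := {X | 0 < X 2} with hH
  have hHopen : IsOpen H :=
    isOpen_lt continuous_const (PiLp.continuous_apply 2 (fun _ : Fin 3 => ℝ) (2 : Fin 3))
  have hHconv : Convex ℝ H := by
    refine convex_halfSpace_gt ⟨fun x y => ?_, fun c x => ?_⟩ 0
    · simp
    · simp
  -- the doubled Bernoulli function `|V|² + 2Q` has zero derivative on `H`
  set B : EuclideanSpace ℝ (Fin 3) → ℝ := fun Z => ‖V Z‖ ^ 2 + (2 : ℝ) • Q Z with hB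
  have hderiv : ∀ Z ∈ H, HasFDerivAt B (0 : EuclideanSpace ℝ (Fin 3) →L[ℝ] ℝ) Z := by
    intro Z hZ
    have hVd : DifferentiableAt ℝ V Z :=
      (hVs.differentiableOn (by simp) Z hZ).differentiableAt (hHopen.mem_nhds hZ)
    have hQd : DifferentiableAt ℝ Q Z :=
      (hQs.differentiableOn (by simp) Z hZ).differentiableAt (hHopen.mem_nhds hZ)
    have h1 : HasFDerivAt (fun Z => ‖V Z‖ ^ 2) (2 • (innerSL ℝ (V Z)).comp (fderiv ℝ V Z)) Z :=
      hVd.hasFDerivAt.norm_sq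
    have h2 : HasFDerivAt (fun Z => (2 : ℝ) • Q Z) ((2 : ℝ) • fderiv ℝ Q Z) Z :=
      hQd.hasFDerivAt.const_smul (2 : ℝ)
    have h12 := h1.add h2
    have hzero : 2 • (innerSL ℝ (V Z)).comp (fderiv ℝ V Z) + (2 : ℝ) • fderiv ℝ Q Z = 0 := by
      refine ContinuousLinearMap.ext fun w => ?_
      have hQw : fderiv ℝ Q Z w = ⟪gradient Q Z, w⟫_ℝ := by
        rw [gradient, InnerProductSpace.toDual_symm_apply]
      have hE : ⟪(fderiv ℝ V Z) (V Z) + gradient Q Z, w⟫_ℝ = 0 := by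
        rw [hEul Z hZ, inner_zero_left]
      rw [inner_add_left, hlamb Z hZ w] at hE
      have hlhs : (2 • (innerSL ℝ (V Z)).comp (fderiv ℝ V Z) + (2 : ℝ) • fderiv ℝ Q Z) w =
          2 • ⟪V Z, fderiv ℝ V Z w⟫_ℝ + (2 : ℝ) • fderiv ℝ Q Z w := by
        simp [innerSL_apply_apply]
      rw [hlhs, hQw]
      simp only [smul_eq_mul, nsmul_eq_mul, Nat.cast_ofNat]
      show 2 * ⟪V Z, (fderiv ℝ V Z) w⟫_ℝ + 2 * ⟪gradient Q Z, w⟫_ℝ = (0 : EuclideanSpace ℝ (Fin 3) →L[ℝ] ℝ) w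
      rw [show (0 : EuclideanSpace ℝ (Fin 3) →L[ℝ] ℝ) w = 0 from rfl]
      linarith
    rw [hzero] at h12
    exact h12
  have hdiff : DifferentiableOn ℝ B H := fun Z hZ => (hderiv Z hZ).differentiableAt.differentiableWithinAt
  have hfw : ∀ Z ∈ H, fderivWithin ℝ B H Z = 0 := by
    intro Z hZ
    rw [fderivWithin_of_isOpen hHopen hZ, (hderiv Z hZ).fderiv]
  have hBXY : B X = B Y := hHconv.is_const_of_fderivWithin_eq_zero hdiff hfw hX hY
  simp only [hB, smul_eq_mul] at hBXY
  linarith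


/-- **Steady Euler flows with vanishing Lamb vector carry no energy flux through the wall-parallel
plane.**  With the hypotheses of `bernoulli_const_of_lamb_zero`, zero mass flux through the unit
square of `X₂ = 1` forces zero energy flux: `∫ V₂ (|V|²/2 + Q) = F` gives `F = 0`. [folklore] -/
theorem flux_eq_zero_of_lamb_zero
    {V : EuclideanSpace ℝ (Fin 3) → EuclideanSpace ℝ (Fin 3)} {Q : EuclideanSpace ℝ (Fin 3) → ℝ} {F : ℝ}
    (hVs : ContDiffOn ℝ ((⊤ : ℕ∞) : WithTop ℕ∞) V {X : EuclideanSpace ℝ (Fin 3) | 0 < X 2})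
    (hQs : ContDiffOn ℝ ((⊤ : ℕ∞) : WithTop ℕ∞) Q {X : EuclideanSpace ℝ (Fin 3) | 0 < X 2})
    (hEul : ∀ X ∈ {X : EuclideanSpace ℝ (Fin 3) | 0 < X 2}, (fderiv ℝ V X) (V X) + gradient Q X = 0)
    (hlamb : ∀ X ∈ {X : EuclideanSpace ℝ (Fin 3) | 0 < X 2}, ∀ b : EuclideanSpace ℝ (Fin 3),
      ⟪fderiv ℝ V X (V X), b⟫_ℝ = ⟪V X, fderiv ℝ V X b⟫_ℝ)
    (hmass : ∫ q in Set.Icc (0 : ℝ) 1 ×ˢ Set.Icc (0 : ℝ) 1, (V !₂[q.1, q.2, (1 : ℝ)]) 2 = 0)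
    (hflux : ∫ q in Set.Icc (0 : ℝ) 1 ×ˢ Set.Icc (0 : ℝ) 1,
      (V !₂[q.1, q.2, (1 : ℝ)]) 2 * (‖V !₂[q.1, q.2, (1 : ℝ)]‖ ^ 2 / 2 + Q !₂[q.1, q.2, (1 : ℝ)])
        = F) :
    F = 0 := by
  have hpt : ∀ a c : ℝ, 0 < (!₂[a, c, (1 : ℝ)] : EuclideanSpace ℝ (Fin 3)) 2 := by
    intro a c; simp
  have h0 : 0 < (!₂[(0 : ℝ), (0 : ℝ), (1 : ℝ)] : EuclideanSpace ℝ (Fin 3)) 2 := hpt 0 0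
  set c₀ : ℝ := ‖V !₂[(0 : ℝ), (0 : ℝ), (1 : ℝ)]‖ ^ 2 / 2 + Q !₂[(0 : ℝ), (0 : ℝ), (1 : ℝ)] with hc₀
  have hconst : ∀ q : ℝ × ℝ,
      ‖V !₂[q.1, q.2, (1 : ℝ)]‖ ^ 2 / 2 + Q !₂[q.1, q.2, (1 : ℝ)] = c₀ := fun q =>
    bernoulli_const_of_lamb_zero hVs hQs hEul hlamb (hpt q.1 q.2) h0
  simp_rw [hconst] at hflux
  rw [integral_mul_const, hmass, zero_mul] at hflux
  exact hflux.symm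

/-- **No half-space hierarchy with vanishing Lamb vector.**  The clause block of crux #2
(`HalfSpaceHierarchy`, written out) together with `ω × V = 0` on the half-space is uninhabited:
potential flows (`V = ∇φ`, `φ` harmonic and `1`-homogeneous — the natural dilation-invariant
candidates) and (generalised) Beltrami flows `ω = λV` are all excluded by `F ≠ 0`. [folklore] -/
theorem not_hierarchyBlock_of_lamb_zero :
    ¬ ∃ (V : EuclideanSpace ℝ (Fin 3) → EuclideanSpace ℝ (Fin 3)) (Q : EuclideanSpace ℝ (Fin 3) → ℝ)
    (C F : ℝ),
      let H : Set (EuclideanSpace ℝ (Fin 3)) := {X | 0 < X 2};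
      let e : Fin 3 → EuclideanSpace ℝ (Fin 3) := fun i => EuclideanSpace.single i (1 : ℝ);
      let pt : ℝ × ℝ → EuclideanSpace ℝ (Fin 3) := fun q => !₂[q.1, q.2, (1 : ℝ)];
      (ContDiffOn ℝ ((⊤ : ℕ∞) : WithTop ℕ∞) V H ∧ ContDiffOn ℝ ((⊤ : ℕ∞) : WithTop ℕ∞) Q H ∧ (∀ X ∈
      H, ‖V X‖ ≤ C ∧ |Q X| ≤ C) ∧ (∀ X ∈ H, ∑ i : Fin 3, (fderiv ℝ V X (e i)) i = 0) ∧ (∀ X ∈ H,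
      (fderiv ℝ V X) (V X) + gradient Q X = 0) ∧ (∀ X ∈ H, V ((2 : ℝ) • X) = V X ∧ Q ((2 : ℝ) • X)
      = Q X) ∧ (∀ X : EuclideanSpace ℝ (Fin 3), 1 ≤ X 2 → X 2 ≤ 2 → V (X + e 0) = V X ∧ V (X + e 1)
      = V X ∧ Q (X + e 0) = Q X ∧ Q (X + e 1) = Q X) ∧ (∫ q in Set.Icc (0 : ℝ) 1 ×ˢ Set.Icc (0 : ℝ)
      1, (V (pt q)) 2 = 0) ∧ F ≠ 0 ∧ (∫ q in Set.Icc (0 : ℝ) 1 ×ˢ Set.Icc (0 : ℝ) 1, (V (pt q)) 2 *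
      (‖V (pt q)‖ ^ 2 / 2 + Q (pt q)) = F)) ∧
      (∀ X ∈ H, ∀ b : EuclideanSpace ℝ (Fin 3), ⟪fderiv ℝ V X (V X), b⟫_ℝ = ⟪V X, fderiv ℝ V X b⟫_ℝ) := by
  rintro ⟨V, Q, C, F, hh⟩
  simp only at hh
  obtain ⟨⟨hVs, hQs, _, _, hEul, _, _, hmass, hF, hflux⟩, hlamb⟩ := hh
  exact hF (flux_eq_zero_of_lamb_zero hVs hQs hEul hlamb hmass hflux)

/-- **The blow-down of a viscous wall profile has a non-trivial Lamb vector.**  The antecedent of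
the crux `DyadicRealisation` (the clause block of `ViscousWallProfile`, written out) together with
`ω × V = 0` for its hierarchy `V` on the half-space is uninhabited — `V` is neither irrotational
nor Beltrami. [folklore] -/
theorem not_profileBlock_of_lamb_zero :
    ¬ ∃ (W : EuclideanSpace ℝ (Fin 3) → EuclideanSpace ℝ (Fin 3)) (P : EuclideanSpace ℝ (Fin 3) → ℝ)
    (V : EuclideanSpace ℝ (Fin 3) → EuclideanSpace ℝ (Fin 3)) (Q : EuclideanSpace ℝ (Fin 3) → ℝ)
    (C F C' : ℝ),
      let H : Set (EuclideanSpace ℝ (Fin 3)) := {X | 0 < X 2};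
      let e : Fin 3 → EuclideanSpace ℝ (Fin 3) := fun i => EuclideanSpace.single i (1 : ℝ);
      let pt : ℝ × ℝ → EuclideanSpace ℝ (Fin 3) := fun q => !₂[q.1, q.2, (1 : ℝ)];
      let σ : EuclideanSpace ℝ (Fin 3) → EuclideanSpace ℝ (Fin 3) := fun X => X - (2 * X 2) • e 2;
      ((ContDiffOn ℝ ((⊤ : ℕ∞) : WithTop ℕ∞) V H ∧ ContDiffOn ℝ ((⊤ : ℕ∞) : WithTop ℕ∞) Q H ∧ (∀ X ∈
      H, ‖V X‖ ≤ C ∧ |Q X| ≤ C) ∧ (∀ X ∈ H, ∑ i : Fin 3, (fderiv ℝ V X (e i)) i = 0) ∧ (∀ X ∈ H,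
      (fderiv ℝ V X) (V X) + gradient Q X = 0) ∧ (∀ X ∈ H, V ((2 : ℝ) • X) = V X ∧ Q ((2 : ℝ) • X)
      = Q X) ∧ (∀ X : EuclideanSpace ℝ (Fin 3), 1 ≤ X 2 → X 2 ≤ 2 → V (X + e 0) = V X ∧ V (X + e 1)
      = V X ∧ Q (X + e 0) = Q X ∧ Q (X + e 1) = Q X) ∧ (∫ q in Set.Icc (0 : ℝ) 1 ×ˢ Set.Icc (0 : ℝ)
      1, (V (pt q)) 2 = 0) ∧ F ≠ 0 ∧ (∫ q in Set.Icc (0 : ℝ) 1 ×ˢ Set.Icc (0 : ℝ) 1, (V (pt q)) 2 *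
      (‖V (pt q)‖ ^ 2 / 2 + Q (pt q)) = F)) ∧ ContDiff ℝ ((⊤ : ℕ∞) : WithTop ℕ∞) W ∧ ContDiff ℝ ((⊤
      : ℕ∞) : WithTop ℕ∞) P ∧ (∀ X, ‖W X‖ ≤ C' ∧ |P X| ≤ C') ∧ (∀ X, W (σ X) = σ (W X) ∧ P (σ X) =
      P X) ∧ (∀ X, ∑ i : Fin 3, (fderiv ℝ W X (e i)) i = 0) ∧ (∀ X, (fderiv ℝ W X) (W X) + gradient
      P X = ∑ i : Fin 3, fderiv ℝ (fun Y => fderiv ℝ W Y (e i)) X (e i)) ∧ (∀ ε : ℝ, 0 < ε → ∃ M :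
      ℕ, ∀ m : ℕ, M ≤ m → ∀ X : EuclideanSpace ℝ (Fin 3), 1 ≤ X 2 → X 2 ≤ 2 → ‖W ((2 : ℝ) ^ m • X)
      - V X‖ ≤ ε ∧ |P ((2 : ℝ) ^ m • X) - Q X| ≤ ε)) ∧
      (∀ X ∈ H, ∀ b : EuclideanSpace ℝ (Fin 3), ⟪fderiv ℝ V X (V X), b⟫_ℝ = ⟪V X, fderiv ℝ V X b⟫_ℝ) := by
  rintro ⟨W, P, V, Q, C, F, C', hh⟩
  simp only at hh
  obtain ⟨⟨⟨hVs, hQs, _, _, hEul, _, _, hmass, hF, hflux⟩, _⟩, hlamb⟩ := hh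
  exact hF (flux_eq_zero_of_lamb_zero hVs hQs hEul hlamb hmass hflux)

/-- **The hierarchy of any viscous wall profile has a non-zero Lamb vector somewhere on the
half-space** (the same fact, hung on the route's support decl `ViscousWallProfile` = the antecedent
of `DyadicRealisation`: every witness `(W, P, V, Q, C, F, C')` has a point `X₂ > 0` and a direction
`b` with `⟪DV(X)(V X), b⟫ ≠ ⟪V X, DV(X) b⟫`, i.e. `(ω × V)(X) ≠ 0`). [folklore] -/
theorem exists_lamb_ne_zero_of_viscousWallProfile
    (h : Summit.AnomalousDissipation.AnomalousDissipation.Theses.DyadicWallCascade.ViscousWallProfile) :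
    ∃ (V : EuclideanSpace ℝ (Fin 3) → EuclideanSpace ℝ (Fin 3)) (X b : EuclideanSpace ℝ (Fin 3)),
      0 < X 2 ∧ ⟪fderiv ℝ V X (V X), b⟫_ℝ ≠ ⟪V X, fderiv ℝ V X b⟫_ℝ := by
  obtain ⟨W, P, V, Q, C, F, C', hh⟩ := h
  simp only at hh
  obtain ⟨⟨hVs, hQs, _, _, hEul, _, _, hmass, hF, hflux⟩, _⟩ := hh
  by_contra hcon
  push Not at hcon
  exact hF (flux_eq_zero_of_lamb_zero hVs hQs hEul (fun X hX b => hcon V X b hX) hmass hflux)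

/-- **No return flow, no energy flux.**  If the vertical velocity `V₂` keeps ONE sign on the unit
square of the plane `X₂ = 1` (all `≥ 0` or all `≤ 0`), the zero-mass-flux clause forces `V₂ = 0`
a.e. on the square (`setIntegral_eq_zero_iff_of_nonneg_ae`; `V` is continuous on the half-space,
which contains the square) and the energy-flux integrand vanishes: `F = 0`.  Only the smoothness,
mass and flux clauses are used. [folklore] -/
theorem flux_eq_zero_of_vertical_sign
    {V : EuclideanSpace ℝ (Fin 3) → EuclideanSpace ℝ (Fin 3)} {Q : EuclideanSpace ℝ (Fin 3) → ℝ} {F : ℝ}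
    (hVs : ContDiffOn ℝ ((⊤ : ℕ∞) : WithTop ℕ∞) V {X : EuclideanSpace ℝ (Fin 3) | 0 < X 2})
    (hsign : (∀ q ∈ Set.Icc (0 : ℝ) 1 ×ˢ Set.Icc (0 : ℝ) 1, 0 ≤ (V !₂[q.1, q.2, (1 : ℝ)]) 2) ∨
      (∀ q ∈ Set.Icc (0 : ℝ) 1 ×ˢ Set.Icc (0 : ℝ) 1, (V !₂[q.1, q.2, (1 : ℝ)]) 2 ≤ 0))
    (hmass : ∫ q in Set.Icc (0 : ℝ) 1 ×ˢ Set.Icc (0 : ℝ) 1, (V !₂[q.1, q.2, (1 : ℝ)]) 2 = 0)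
    (hflux : ∫ q in Set.Icc (0 : ℝ) 1 ×ˢ Set.Icc (0 : ℝ) 1,
      (V !₂[q.1, q.2, (1 : ℝ)]) 2 * (‖V !₂[q.1, q.2, (1 : ℝ)]‖ ^ 2 / 2 + Q !₂[q.1, q.2, (1 : ℝ)])
        = F) :
    F = 0 := by
  set S : Set (ℝ × ℝ) := Set.Icc (0 : ℝ) 1 ×ˢ Set.Icc (0 : ℝ) 1 with hS
  set g : ℝ × ℝ → ℝ := fun q => (V !₂[q.1, q.2, (1 : ℝ)]) 2 with hg
  have hpt_cont : Continuous (fun q : ℝ × ℝ => (!₂[q.1, q.2, (1 : ℝ)] : EuclideanSpace ℝ (Fin 3))) := by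
    fun_prop
  have hpt_mem : ∀ q : ℝ × ℝ,
      (!₂[q.1, q.2, (1 : ℝ)] : EuclideanSpace ℝ (Fin 3)) ∈ {X : EuclideanSpace ℝ (Fin 3) | 0 < X 2} := by
    intro q; simp
  have hVq : Continuous (fun q : ℝ × ℝ => V !₂[q.1, q.2, (1 : ℝ)]) :=
    hVs.continuousOn.comp_continuous hpt_cont hpt_mem
  have hg_cont : Continuous g :=
    (PiLp.continuous_apply 2 (fun _ : Fin 3 => ℝ) (2 : Fin 3)).comp hVq
  have hScpt : IsCompact S := isCompact_Icc.prod isCompact_Icc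
  have hSmeas : MeasurableSet S := hScpt.measurableSet
  have hg_int : IntegrableOn g S := hg_cont.continuousOn.integrableOn_compact hScpt
  -- `g = 0` a.e. on the square, in both sign cases
  have hae0 : g =ᵐ[volume.restrict S] 0 := by
    rcases hsign with hpos | hneg
    · refine (setIntegral_eq_zero_iff_of_nonneg_ae ?_ hg_int).1 hmass
      rw [Filter.EventuallyLE, ae_restrict_iff' hSmeas]
      exact Filter.Eventually.of_forall hpos
    · have hneg_int : IntegrableOn (fun q => -g q) S := hg_int.neg
      have hmass' : ∫ q in S, -g q = 0 := by rw [integral_neg, hmass, neg_zero]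
      have h1 : (fun q => -g q) =ᵐ[volume.restrict S] 0 := by
        refine (setIntegral_eq_zero_iff_of_nonneg_ae ?_ hneg_int).1 hmass'
        rw [Filter.EventuallyLE, ae_restrict_iff' hSmeas]
        exact Filter.Eventually.of_forall fun q hq => by simpa using hneg q hq
      filter_upwards [h1] with q hq
      simpa using hq
  have hint0 : (fun q : ℝ × ℝ =>
      (V !₂[q.1, q.2, (1 : ℝ)]) 2 * (‖V !₂[q.1, q.2, (1 : ℝ)]‖ ^ 2 / 2 + Q !₂[q.1, q.2, (1 : ℝ)]))
        =ᵐ[volume.restrict S] fun _ => 0 := by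
    filter_upwards [hae0] with q hq
    have : g q = 0 := hq
    simp only [hg] at this
    rw [this, zero_mul]
  rw [integral_congr_ae hint0, integral_zero] at hflux
  exact hflux.symm

/-- **Every viscous wall profile has a down-draft AND an up-draft through the unit square of
`X₂ = 1`** (hung on the route decl `ViscousWallProfile` = the antecedent of `DyadicRealisation`):
one-signed vertical velocity there would kill the energy flux (`flux_eq_zero_of_vertical_sign`).
In particular `V₂` vanishes somewhere on the square, and "fountain" pictures (fluid crossing the
square in one direction only, returning elsewhere) are not hierarchies. [folklore] -/
theorem exists_downdraft_and_updraft_of_viscousWallProfile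
    (h : Summit.AnomalousDissipation.AnomalousDissipation.Theses.DyadicWallCascade.ViscousWallProfile) :
    ∃ (V : EuclideanSpace ℝ (Fin 3) → EuclideanSpace ℝ (Fin 3)) (q q' : ℝ × ℝ),
      q ∈ Set.Icc (0 : ℝ) 1 ×ˢ Set.Icc (0 : ℝ) 1 ∧ q' ∈ Set.Icc (0 : ℝ) 1 ×ˢ Set.Icc (0 : ℝ) 1 ∧
      (V !₂[q.1, q.2, (1 : ℝ)]) 2 < 0 ∧ 0 < (V !₂[q'.1, q'.2, (1 : ℝ)]) 2 := by
  obtain ⟨W, P, V, Q, C, F, C', hh⟩ := h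
  simp only at hh
  obtain ⟨⟨hVs, _, _, _, _, _, _, hmass, hF, hflux⟩, _⟩ := hh
  by_contra hcon
  push Not at hcon
  apply hF
  refine flux_eq_zero_of_vertical_sign (Q := Q) hVs ?_ hmass hflux
  by_cases hex : ∃ q ∈ Set.Icc (0 : ℝ) 1 ×ˢ Set.Icc (0 : ℝ) 1, (V !₂[q.1, q.2, (1 : ℝ)]) 2 < 0
  · obtain ⟨q, hq, hqneg⟩ := hex
    exact Or.inr fun q' hq' => hcon V q q' hq hq' hqneg
  · push Not at hex
    exact Or.inl hex

end DyadicWallCascadeNegative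

end Summit.AnomalousDissipation.AnomalousDissipation.Theorems
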